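import Literature.AlgebraicGeometry.AbelianSchemes.AbelianSchemeDualPairNormalize
import Literature.AlgebraicGeometry.AbelianSchemes.PoincareUnitHypothesisBaseChange
import HarnessLib

/-!
# The renormalised Poincaré sheaf COMMUTES with cartesian charts: `(G ×_g Ĝ)^*(𝒫 ⊗ (pr_A^*M)^∨) ≅ 𝒫′ ⊗ (pr_{A′}^*M′)^∨`,
# and renormalising a normalised pair changes nothing (`N_D ≅ 𝒪 ⇒ 𝒫 ⊗ (pr_A^*M)^∨ ≅ 𝒫`)

Layer `Literature/AlgebraicGeometry/AbelianSchemes`, namespaces `Literature.AlgebraicGeometry.AbelianSchemes.AbelianSchemeOver.DualPair` and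
`….PolarizedAbelianSchemeWithLevel`.  THEOREMS ONLY (no def, no instance, no notation, no `sorry`).  Cell `hodgecm-mathlib` (D-0151), repair
road R2⁺ (director s259), third brick of the «second normalisation» lineage after ★ `PoincareUnitHypothesisBaseChange` (the defect
`N_D := 𝒫|_{A × {ε_Â}}` is TRANSPORTED: `N_{D′} ≅ G^*N_D`) and ★ `PolarizationNormalize` (polarisations survive ★ `DualPair.normalize`).

SETTING as in ★ `PoincareUnitHypothesisBaseChange`: dual pairs `D = (Â, 𝒫)` of `A / S` and `D′ = (Â′, 𝒫′)` of `A′ / S′`, a chart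
`G : A′ → A`, `Ĝ : Â′ → Â` over `g : S′ → S` with `ε_Â′ ≫ Ĝ = g ≫ ε_Â` and the Poincaré clause `(G ×_g Ĝ)^*𝒫 ≅ 𝒫′` (★
`PolarizedAbelianSchemeWithLevel.IsBaseChangeVia`, [MumfordFogartyKirwan1994, Def. 7.2]).  ★ `DualPair.normalize` replaces `𝒫` by
`𝒫 ⊗ (pr_A^*M)^∨`, `M := N_D` ([MumfordFogartyKirwan1994, Ch. 6 §2 (p. 121)]: the normalised Poincaré sheaf; [MilneAV2008, I §8]).  On determinant
classes in `Ȟ¹(·, 𝒪^×)` (★ `detClass_pullback_normalizeP`, ★ `nonempty_iso_iff_detClass_eq`):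

* `DualPair.nonempty_normalizeP_iso_of_nonempty_unitHatSlice_iso` — **`N_D ≅ 𝒪 ⇒ D.normalizeP ≅ 𝒫`**: renormalising a pair that already carries the
  second normalisation changes the Poincaré sheaf only up to isomorphism (`[𝒫]·(pr_A^*[N_D])⁻¹ = [𝒫]`);
* `DualPair.pullback_map_comp_fst_comp_unitHatSlice` — `(G × Ĝ) ≫ pr_A ≫ (1 × ε_Â) = pr_{A′} ≫ (1 × ε_Â′) ≫ (G × Ĝ)`;
* **`DualPair.nonempty_pullback_map_normalizeP_iso`** — `(G ×_g Ĝ)^*(D.normalizeP) ≅ D′.normalizeP`: THE POINCARÉ CLAUSE SURVIVES RENORMALISATION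
  ON BOTH SIDES (`(G×Ĝ)^*[𝒫]·((G×Ĝ) ≫ pr_A ≫ (1×ε_Â))^*[𝒫]⁻¹ = [𝒫′]·(pr_{A′}^*(1×ε_Â′)^*[𝒫′])⁻¹`);
* `DualPair.nonempty_pullback_map_normalizeP_iso_of_nonempty_unitHatSlice_iso` — the MIXED form: if `D′` already carries `N_{D′} ≅ 𝒪`, then
  `(G ×_g Ĝ)^*(D.normalizeP) ≅ 𝒫′` — i.e. **the relation `IsBaseChangeVia` from a normalised `P′` to a raw `P` PERSISTS after replacing `P.D` by
  `P.D.normalize`** (the step a deformation-theoretic producer of lifts needs under R2⁺: build the lift raw, renormalise, keep the chart);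
* `DualPair.nonempty_pullback_map_normalizeP_iso_of_hat_isBaseChangeVia` (unit clause read off `D′.hat.IsBaseChangeVia D.hat g Ĝ`);
* **`PolarizedAbelianSchemeWithLevel.IsBaseChangeVia.nonempty_pullback_map_normalizeP_iso`** — for triples: `P′.IsBaseChangeVia P f G Ĝ` and
  `hP′ : N_{P′.D} ≅ 𝒪` give the Poincaré clause of the same chart towards `P.D.normalize` with target `P′.D.P`; and
  `…_normalizeP_iso_normalizeP` (target `P′.D.normalizeP`, hypothesis-free).

HC_CM is proved only modulo the 7 printed citations until rung 0 closes; nothing here is about HC.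

## References
* [MumfordFogartyKirwan1994] D. Mumford, J. Fogarty, F. Kirwan, *Geometric Invariant Theory*, 3rd ed. (1994), Ch. 6 §2 (p. 121) (normalised
  Poincaré sheaf); Ch. 7 §2 Definition 7.2 (p. 129) (pull-back functor).
* [MilneAV2008] J. S. Milne, *Abelian Varieties* (v2.00, 2008), I §8 pp. 36–37.
* [Hartshorne1977] R. Hartshorne, *Algebraic Geometry* (1977), II Ex. 6.11 (determinant classes).
-/

noncomputable section

-- `Scheme.Modules` / `SheafOfModules` are not reducible (as in ★ `AbelianSchemeDualPairNormalize`).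
set_option backward.isDefEq.respectTransparency false

universe u

open CategoryTheory CategoryTheory.Limits AlgebraicGeometry MonoidalCategory

namespace Literature.AlgebraicGeometry.AbelianSchemes

namespace AbelianSchemeOver

open Literature.AlgebraicGeometry.Motives Literature.AlgebraicGeometry.AbelianVarieties
  Literature.AlgebraicGeometry.Modules
open scoped MonObj

namespace DualPair

variable {S S' : Scheme.{u}} {A : AbelianSchemeOver S} {A' : AbelianSchemeOver S'} (D : A.DualPair) (D' : A'.DualPair)
  {g : S' ⟶ S} {G : A'.X.left ⟶ A.X.left} {Ĝ : D'.hat.X.left ⟶ D.hat.X.left}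

/-! ### §1 Renormalising a normalised pair -/

/-- **`N_D ≅ 𝒪 ⇒ 𝒫 ⊗ (pr_A^*M)^∨ ≅ 𝒫`**: if the Poincaré sheaf is already trivial on `A × {ε_Â}`, renormalisation (★ `DualPair.normalize`)
does not change it up to isomorphism (`[𝒫 ⊗ (pr_A^*M)^∨] = [𝒫] · (pr_A^*[M])⁻¹ = [𝒫] · 1`, ★ `detClass_normalizeP`).
[cite: MumfordFogartyKirwan1994, Ch. 6 §2 (p. 121)] [cite: MilneAV2008, I §8 pp. 36–37] [cite: Hartshorne1977, II Ex. 6.11] -/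
theorem nonempty_normalizeP_iso_of_nonempty_unitHatSlice_iso
    (hD : Nonempty ((Scheme.Modules.pullback (unitHatSlice D)).obj D.P ≅ SheafOfModules.unit _)) :
    Nonempty (D.normalizeP ≅ D.P) := by
  have hP := D.hasRank_one
  have hP₁ := HasRank.isFiniteLocallyFree' hP
  have hN := D.hasRank_normalizeP
  have hN₁ := HasRank.isFiniteLocallyFree' hN
  obtain ⟨m⟩ := hD
  have hm : CechPic.pullback (unitHatSlice D) (detClass hP₁) = 1 := by
    rw [← detClass_pullback (hE := hP₁),
      detClass_eq_of_iso m (hP₁.pullback _) (HasRank.isFiniteLocallyFree' hasRank_unitModule)]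
    exact detClass_unitModule_eq_one _
  refine (nonempty_iso_iff_detClass_eq hN hP hN₁ hP₁).2 ?_
  rw [D.detClass_normalizeP hN₁, hm, map_one, inv_one, mul_one]

/-! ### §2 The renormalised sheaf and cartesian charts -/

/-- **`(G × Ĝ) ≫ pr_A ≫ (1_A × ε_Â) = pr_{A′} ≫ (1_{A′} × ε_Â′) ≫ (G × Ĝ)`** (both are `(G ∘ pr_{A′}, ε_Â ∘ π ∘ G ∘ pr_{A′})`; ★
`unitHatSlice_comp_pullback_map`). [cite: MumfordFogartyKirwan1994, Ch. 6 §2 (p. 121)] -/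
theorem pullback_map_comp_fst_comp_unitHatSlice (wG : A'.X.hom ≫ g = G ≫ A.X.hom)
    (wĜ : D'.hat.X.hom ≫ g = Ĝ ≫ D.hat.X.hom) (hε : D'.hat.unitSection ≫ Ĝ = g ≫ D.hat.unitSection) :
    pullback.map A'.X.hom D'.hat.X.hom A.X.hom D.hat.X.hom G Ĝ g wG wĜ ≫ pullback.fst A.X.hom D.hat.X.hom ≫ unitHatSlice D =
      pullback.fst A'.X.hom D'.hat.X.hom ≫ unitHatSlice D' ≫
        pullback.map A'.X.hom D'.hat.X.hom A.X.hom D.hat.X.hom G Ĝ g wG wĜ := by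
  rw [pullback.lift_fst_assoc, Category.assoc, unitHatSlice_comp_pullback_map D D' wG wĜ hε]

/-- **THE POINCARÉ CLAUSE SURVIVES RENORMALISATION ON BOTH SIDES: `(G ×_g Ĝ)^*(𝒫 ⊗ (pr_A^*M)^∨) ≅ 𝒫′ ⊗ (pr_{A′}^*M′)^∨`** — given
`(G ×_g Ĝ)^*𝒫 ≅ 𝒫′` and `ε_Â′ ≫ Ĝ = g ≫ ε_Â`.  On classes: `(G×Ĝ)^*[𝒫] · (((G×Ĝ) ≫ pr_A ≫ (1×ε_Â))^*[𝒫])⁻¹ = [𝒫′] · ((pr_{A′} ≫ (1×ε_Â′))^*(G×Ĝ)^*[𝒫])⁻¹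
= [𝒫′] · ((pr_{A′} ≫ (1×ε_Â′))^*[𝒫′])⁻¹` (★ `detClass_pullback_normalizeP`, ★ `detClass_normalizeP`, §2 identity).
[cite: MumfordFogartyKirwan1994, Ch. 6 §2 (p. 121) and Ch. 7 §2 Definition 7.2 (p. 129)] [cite: MilneAV2008, I §8 pp. 36–37] [cite: Hartshorne1977, II Ex. 6.11] -/
theorem nonempty_pullback_map_normalizeP_iso (wG : A'.X.hom ≫ g = G ≫ A.X.hom)
    (wĜ : D'.hat.X.hom ≫ g = Ĝ ≫ D.hat.X.hom) (hε : D'.hat.unitSection ≫ Ĝ = g ≫ D.hat.unitSection)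
    (hP : Nonempty ((Scheme.Modules.pullback
      (pullback.map A'.X.hom D'.hat.X.hom A.X.hom D.hat.X.hom G Ĝ g wG wĜ)).obj D.P ≅ D'.P)) :
    Nonempty ((Scheme.Modules.pullback
      (pullback.map A'.X.hom D'.hat.X.hom A.X.hom D.hat.X.hom G Ĝ g wG wĜ)).obj D.normalizeP ≅ D'.normalizeP) := by
  have hP₀ := D.hasRank_one
  have hP₁ := HasRank.isFiniteLocallyFree' hP₀
  have hN := D.hasRank_normalizeP
  have hN₁ := HasRank.isFiniteLocallyFree' hN
  have hP₀' := D'.hasRank_one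
  have hP₁' := HasRank.isFiniteLocallyFree' hP₀'
  have hN' := D'.hasRank_normalizeP
  have hN₁' := HasRank.isFiniteLocallyFree' hN'
  obtain ⟨e⟩ := hP
  -- `(G×Ĝ)^*[𝒫] = [𝒫′]`
  have he : CechPic.pullback (pullback.map A'.X.hom D'.hat.X.hom A.X.hom D.hat.X.hom G Ĝ g wG wĜ) (detClass hP₁) =
      detClass hP₁' := by
    rw [← detClass_pullback (hE := hP₁)]
    exact detClass_eq_of_iso e (hP₁.pullback _) hP₁'
  refine (nonempty_iso_iff_detClass_eq (hasRank_pullback _ hN) hN' (hN₁.pullback _) hN₁').2 ?_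
  rw [D.detClass_pullback_normalizeP _ (hN₁.pullback _), D.pullback_map_comp_fst_comp_unitHatSlice D' wG wĜ hε,
    CechPic.pullback_comp, CechPic.pullback_comp, he, D'.detClass_normalizeP hN₁']

/-- **THE MIXED FORM: `(G ×_g Ĝ)^*(𝒫 ⊗ (pr_A^*M)^∨) ≅ 𝒫′` when `D′` already carries `N_{D′} ≅ 𝒪`** — the Poincaré clause of a chart from
a NORMALISED pair `D′` to a raw pair `D` persists after renormalising `D` (§2 + §1 for `D′`).  This is the step a producer of lifts needs
under the cell's repair road R2⁺: construct the lift with a raw dual pair, renormalise it (★ `DualPair.normalize`), keep the chart.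
[cite: MumfordFogartyKirwan1994, Ch. 6 §2 (p. 121) and Ch. 7 §2 Definition 7.2 (p. 129)] [cite: MilneAV2008, I §8 pp. 36–37] -/
theorem nonempty_pullback_map_normalizeP_iso_of_nonempty_unitHatSlice_iso (wG : A'.X.hom ≫ g = G ≫ A.X.hom)
    (wĜ : D'.hat.X.hom ≫ g = Ĝ ≫ D.hat.X.hom) (hε : D'.hat.unitSection ≫ Ĝ = g ≫ D.hat.unitSection)
    (hP : Nonempty ((Scheme.Modules.pullback
      (pullback.map A'.X.hom D'.hat.X.hom A.X.hom D.hat.X.hom G Ĝ g wG wĜ)).obj D.P ≅ D'.P))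
    (hD' : Nonempty ((Scheme.Modules.pullback (unitHatSlice D')).obj D'.P ≅ SheafOfModules.unit _)) :
    Nonempty ((Scheme.Modules.pullback
      (pullback.map A'.X.hom D'.hat.X.hom A.X.hom D.hat.X.hom G Ĝ g wG wĜ)).obj D.normalizeP ≅ D'.P) := by
  obtain ⟨i⟩ := D.nonempty_pullback_map_normalizeP_iso D' wG wĜ hε hP
  obtain ⟨j⟩ := D'.nonempty_normalizeP_iso_of_nonempty_unitHatSlice_iso hD'
  exact ⟨i ≪≫ j⟩

/-- The mixed form with the unit clause and `wĜ` read off `D′.hat.IsBaseChangeVia D.hat g Ĝ` (★ `AbelianSchemeOver.IsBaseChangeVia`).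
[cite: MumfordFogartyKirwan1994, Ch. 6 §2 (p. 121) and Ch. 7 §2 Definition 7.2 (p. 129)] -/
theorem nonempty_pullback_map_normalizeP_iso_of_hat_isBaseChangeVia (hĜ : D'.hat.IsBaseChangeVia D.hat g Ĝ)
    (wG : A'.X.hom ≫ g = G ≫ A.X.hom)
    (hP : Nonempty ((Scheme.Modules.pullback
      (pullback.map A'.X.hom D'.hat.X.hom A.X.hom D.hat.X.hom G Ĝ g wG hĜ.1.symm)).obj D.P ≅ D'.P))
    (hD' : Nonempty ((Scheme.Modules.pullback (unitHatSlice D')).obj D'.P ≅ SheafOfModules.unit _)) :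
    Nonempty ((Scheme.Modules.pullback
      (pullback.map A'.X.hom D'.hat.X.hom A.X.hom D.hat.X.hom G Ĝ g wG hĜ.1.symm)).obj D.normalizeP ≅ D'.P) :=
  D.nonempty_pullback_map_normalizeP_iso_of_nonempty_unitHatSlice_iso D' wG hĜ.1.symm hĜ.2.2.1 hP hD'

end DualPair

end AbelianSchemeOver

namespace PolarizedAbelianSchemeWithLevel

open AbelianSchemeOver

variable {g N : ℕ} {δ : Fin g → ℕ}

/-- **For triples: the Poincaré clause of `P′.IsBaseChangeVia P f G Ĝ` survives renormalising BOTH dual pairs** —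
`(G ×_f Ĝ)^*(P.D.normalizeP) ≅ P′.D.normalizeP` (hypothesis-free).
[cite: MumfordFogartyKirwan1994, Ch. 6 §2 (p. 121) and Ch. 7 §2 Definition 7.2 (p. 129)] [cite: MilneAV2008, I §8 pp. 36–37] -/
theorem IsBaseChangeVia.nonempty_pullback_map_normalizeP_iso_normalizeP {S T : Scheme.{u}}
    {P' : PolarizedAbelianSchemeWithLevel g N δ T} {P : PolarizedAbelianSchemeWithLevel g N δ S} {f : T ⟶ S}
    {G : P'.A.X.left ⟶ P.A.X.left} {Ĝ : P'.D.hat.X.left ⟶ P.D.hat.X.left} (h : P'.IsBaseChangeVia P f G Ĝ) :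
    ∃ (wG : P'.A.X.hom ≫ f = G ≫ P.A.X.hom) (wĜ : P'.D.hat.X.hom ≫ f = Ĝ ≫ P.D.hat.X.hom),
      Nonempty ((Scheme.Modules.pullback
        (pullback.map P'.A.X.hom P'.D.hat.X.hom P.A.X.hom P.D.hat.X.hom G Ĝ f wG wĜ)).obj P.D.normalizeP ≅ P'.D.normalizeP) := by
  obtain ⟨-, ⟨w, -, hη, -⟩, ⟨wG, wĜ, hPc⟩, -⟩ := h
  exact ⟨wG, wĜ, DualPair.nonempty_pullback_map_normalizeP_iso P.D P'.D wG wĜ hη hPc⟩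

/-- **For triples, mixed form: if `P′` carries the second normalisation `N_{P′.D} ≅ 𝒪`, the Poincaré clause of `P′.IsBaseChangeVia P f G Ĝ`
holds towards the RENORMALISED `P.D.normalize` with the same `𝒫′`** — `(G ×_f Ĝ)^*(P.D.normalizeP) ≅ P′.D.P`.  With ★ `normalize_hat` (`rfl`)
the `hat`-clause, the `λ`-clause (★ `PolarizationNormalize`: same `λ`) and the level clause of `IsBaseChangeVia` are untouched, so the relation
`P′.IsBaseChangeVia (P with D := P.D.normalize, …) f G Ĝ` is available to any constructor that renormalises `P`.
[cite: MumfordFogartyKirwan1994, Ch. 6 §2 (p. 121) and Ch. 7 §2 Definition 7.2 (p. 129)] [cite: MilneAV2008, I §8 pp. 36–37] -/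
theorem IsBaseChangeVia.nonempty_pullback_map_normalizeP_iso {S T : Scheme.{u}}
    {P' : PolarizedAbelianSchemeWithLevel g N δ T} {P : PolarizedAbelianSchemeWithLevel g N δ S} {f : T ⟶ S}
    {G : P'.A.X.left ⟶ P.A.X.left} {Ĝ : P'.D.hat.X.left ⟶ P.D.hat.X.left} (h : P'.IsBaseChangeVia P f G Ĝ)
    (hP' : Nonempty ((Scheme.Modules.pullback (DualPair.unitHatSlice P'.D)).obj P'.D.P ≅ SheafOfModules.unit _)) :
    ∃ (wG : P'.A.X.hom ≫ f = G ≫ P.A.X.hom) (wĜ : P'.D.hat.X.hom ≫ f = Ĝ ≫ P.D.hat.X.hom),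
      Nonempty ((Scheme.Modules.pullback
        (pullback.map P'.A.X.hom P'.D.hat.X.hom P.A.X.hom P.D.hat.X.hom G Ĝ f wG wĜ)).obj P.D.normalizeP ≅ P'.D.P) := by
  obtain ⟨-, ⟨w, -, hη, -⟩, ⟨wG, wĜ, hPc⟩, -⟩ := h
  exact ⟨wG, wĜ, DualPair.nonempty_pullback_map_normalizeP_iso_of_nonempty_unitHatSlice_iso P.D P'.D wG wĜ hη hPc hP'⟩

end PolarizedAbelianSchemeWithLevel

end Literature.AlgebraicGeometry.AbelianSchemes

end
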